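import Mathlib
import Summits.Ventures.PercRepro2.SevenTypedAbstract
import Summits.Ventures.PercRepro2.SevenTypedDomLeaf

set_option Elab.async false

/-!
# Seven typed edges, IX.D6: kernel groups of the DOMAIN-RESTRICTED rung (blind cell PercRepro2,
night-3 g9, 2026-08-25)

`shard7_d okQ7Dom` on guarded canonical prefixes, by `decide +kernel` (the leaf test = outside the domain of
record by a label / state guard, or the 128 cube tests); prefixes with many leaves are sliced by the next
positions and re-assembled by `interval_cases` (`gd_eq_of_true7`).  Self-contained subtrees; estimated kernel
cost 66 s.
-/

namespace Summit.Ventures.PercRepro2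

open UnionCluster

namespace CovForm

namespace TwoTyped

open OneTyped

section ShardsD

set_option maxHeartbeats 0 in
/-- kernel group: the guarded subtree of the prefix `1 2 3 3 0 2 1 3` (depth 8) under the leaf test `okQ7Dom`. -/
theorem sh7D_1_2_3_3_0_2_1_3 : shard7_8 okQ7Dom 1 2 3 3 0 2 1 3 = true := by decide +kernel

set_option maxHeartbeats 0 in
/-- kernel group: the guarded subtree of the prefix `1 2 3 3 0 2 1 8 1` (depth 9) under the leaf test `okQ7Dom`. -/
theorem sh7D_1_2_3_3_0_2_1_8_1 : shard7_9 okQ7Dom 1 2 3 3 0 2 1 8 1 = true := by decide +kernel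

set_option maxHeartbeats 0 in
/-- kernel group: the guarded subtree of the prefix `1 2 3 3 0 2 1 8 2` (depth 9) under the leaf test `okQ7Dom`. -/
theorem sh7D_1_2_3_3_0_2_1_8_2 : shard7_9 okQ7Dom 1 2 3 3 0 2 1 8 2 = true := by decide +kernel

set_option maxHeartbeats 0 in
/-- kernel group: the guarded subtree of the prefix `1 2 3 3 0 2 1 8 3` (depth 9) under the leaf test `okQ7Dom`. -/
theorem sh7D_1_2_3_3_0_2_1_8_3 : shard7_9 okQ7Dom 1 2 3 3 0 2 1 8 3 = true := by decide +kernel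

set_option maxHeartbeats 0 in
/-- the canonical 8-prefix `1 2 3 3 0 2 1 8` re-assembled from its children by `interval_cases`. -/
theorem sh7D_1_2_3_3_0_2_1_8 : shard7_8 okQ7Dom 1 2 3 3 0 2 1 8 = true := by unfold shard7_8; rw [List.all_eq_true]; intro a ha; rw [List.mem_range] at ha; interval_cases a; exacts [(by decide +kernel), sh7D_1_2_3_3_0_2_1_8_1, sh7D_1_2_3_3_0_2_1_8_2, sh7D_1_2_3_3_0_2_1_8_3, (by decide +kernel), (by decide +kernel), (by decide +kernel), (by decide +kernel), (by decide +kernel), (by decide +kernel)]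

set_option maxHeartbeats 0 in
/-- kernel group: the guarded subtree of the prefix `1 2 3 3 0 2 2 3` (depth 8) under the leaf test `okQ7Dom`. -/
theorem sh7D_1_2_3_3_0_2_2_3 : shard7_8 okQ7Dom 1 2 3 3 0 2 2 3 = true := by decide +kernel

set_option maxHeartbeats 0 in
/-- kernel group: the guarded subtree of the prefix `1 2 3 3 0 2 2 8` (depth 8) under the leaf test `okQ7Dom`. -/
theorem sh7D_1_2_3_3_0_2_2_8 : shard7_8 okQ7Dom 1 2 3 3 0 2 2 8 = true := by decide +kernel

set_option maxHeartbeats 0 in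
/-- kernel group: the guarded subtree of the prefix `1 2 3 3 0 2 3 8` (depth 8) under the leaf test `okQ7Dom`. -/
theorem sh7D_1_2_3_3_0_2_3_8 : shard7_8 okQ7Dom 1 2 3 3 0 2 3 8 = true := by decide +kernel

set_option maxHeartbeats 0 in
/-- kernel group: the guarded subtree of the prefix `1 2 3 3 0 2 7 8` (depth 8) under the leaf test `okQ7Dom`. -/
theorem sh7D_1_2_3_3_0_2_7_8 : shard7_8 okQ7Dom 1 2 3 3 0 2 7 8 = true := by decide +kernel


end ShardsD

end TwoTyped

end CovForm

end Summit.Ventures.PercRepro2
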